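import Summits.CriticalPhenomena.CardyFormulaZ2.Theses.CardyDualCurrent
import Summits.CriticalPhenomena.CardyFormulaZ2.Theorems.CardyDualCurrentDualCurrentTemplateRStubBlockResummation
import Summits.CriticalPhenomena.CardyFormulaZ2.Theorems.CardyDualCurrentDualCurrentTemplateRStubIntegrandIntegrable
import Summits.CriticalPhenomena.CardyFormulaZ2.Theorems.CardyDualCurrentDualCurrentTemplateRStubObsEqBlockAverage
import Literature.Probability.LatticeModels.LocalParafermionicTemplate
import HarnessLib

/-!
# Birth skeleton for the crux `CardyDualCurrent.DualCurrentTemplateR`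
(item `stmt-CriticalPhenomena-11201`, route `route-CriticalPhenomena-CardyDualCurrent`, sub-problem
`CardyFormulaZ2`; BC3 skeleton registered by the skeleton registrar, 2026-08-17)

The crux `X` (rank 2, the route's thesis itself): there is a finite-range LOCAL PARAFERMIONIC
TEMPLATE `T = (r, m, z, s, g)` whose `p = 1/2` bond-percolation expectation
`G_D(x, i) = T.obs D x i` is EXACTLY discrete holomorphic — Duffin's Cauchy–Riemann relation at
every `r`-deep primal vertex and primal face — in every admissible discrete Dobrushin domain of
`δℤ²` with preconnected wired arc, and non-constant between `(r+2)`-deep windows in some such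
domain.  Over the Literature structure `LocalParafermionicTemplate` (definition item
`defn-LocalParafermionicTemplate`) the crux reads `∃ T, T.IsExactCR ∧ T.Nondegenerate`
(`LocalParafermionicTemplate.exists_isExactCR_and_nondegenerate_iff`, a binder re-bracketing,
grounder-verified against the route file 2026-08-15).

## The line (`birth`: local resummation — the shape in which every exact lattice identity is
## actually proved — plus finitary certificates)

Every exact linear identity known for an interface observable of a planar lattice model
(Duminil-Copin–Smirnov 2012 Prop. 8.6 / Duminil-Copin 2012 Prop. 4 at general `q`; Smirnov's
s-holomorphicity at `q = 2`) is proved POINTWISE IN THE EXTERIOR: one freezes the configuration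
outside a finite block `B` of edges around the stencil and shows that the sum of the defect over
the `2^|B|` configurations of the block vanishes (for Prop. 8.6, `B = {e}`: the edge-flip
pairing `ω ↔ ω ∆ {e}`).  At `p = 1/2`, `q = 1` the block configuration is uniform and independent
of the exterior, so such a *block-resummation identity* integrates to the identity in
expectation.  The skeleton cuts the crux along this seam:

* `integrand T D ω x i` — the integrand of `T.obs` (`T.obs D x i = ∫ integrand ∂P_{1/2}` by
  `rfl`, `obs_eq_integral_integrand`); `vertexDefect` / `faceDefect` — the two Duffin CR defects
  of the integrand, configuration by configuration; `edgeBox x ρ` — the lattice edges with both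
  endpoints within sup-distance `ρ` of `x` (the resummation block); `blockSum B Φ ω` — the sum of
  `Φ` over the configurations of the block `B` with the exterior `ω \ B` frozen;
  `blockAverage E Φ` — the uniform average of `Φ` over the configurations supported in `E`.
* `IsLocallyCR T` — **`T` is locally Cauchy–Riemann**: for some block radius `ρ`, in every
  admissible domain with preconnected wired arc, at every vertex stencil and every face stencil
  whose four windows are `T.r`-deep, the block resummation of the CR defect vanishes FOR EVERY
  exterior configuration.  (Strictly stronger than `T.IsExactCR`; for fixed `T, ρ` each instance
  is a finite identity given the exterior interface datum.)
* `stub_localToGlobal` — **local CR integrates to exact CR**: `IsLocallyCR T → T.IsExactCR`.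
  True and provable now (size M–L): the integrand is a bounded cylinder function for admissible
  `D` (finite `Ω_δ`; `measurable_of_medialExploration`), `P_{1/2}` is invariant under toggling
  any edge of `ℤ²` (`bondPercolation_half_map_toggle`, Theorems file
  `CardyComplexConeCoherentMoreraKirchhoffFlip`), hence `∫ Φ = 2^{-|B|} ∫ blockSum B Φ`, and
  linearity of the Bochner integral turns `∫ defect = 0` into the CR clause of `IsExactCRIn`.
* `stub_obsEqBlockAverage` — **the observable of an admissible domain is a finite uniform
  average**: for `E(Ω_δ) ⊆ E ⊆ E(ℤ²)` finite and `x` deep,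
  `T.obs D x i = 2^{-|E|} Σ_{η ⊆ E} integrand T D η x i`.  True and provable now (size M): the
  integrand reads `ω` only through `D.bcBondConfig ω ⊆ E(Ω_δ)` and the translated window
  (`⊆ D.innerMedialVertices ⊆ E(Ω_δ)` by depth), and the `E`-marginal of `setBer(E(ℤ²), 1/2)` is
  uniform (`bondPercolation_half_cylinderEvent`).  This is also the lemma that makes the census
  items `NoDualCurrentRangeZero/One` and any non-degeneracy claim a finite exact computation.
* `stub_localSolution` — **the heart (open)**: some template is locally CR AND has an explicit
  finite non-constancy certificate — an admissible `D` with preconnected wired arc, a finite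
  edge set `E(Ω_δ) ⊆ E ⊆ E(ℤ²)`, and two `(T.r + 2)`-deep base points `x, x'` of one type `i` at
  which the block averages of the integrand differ.  For a candidate `T` both conjuncts are
  finite exact computations (the second outright; the first per exterior interface datum), i.e.
  exactly what the route's kit census enumerator decides range by range (`NoDualCurrentRangeZero`
  evidence: kernel `{0}` at range 0, job j017402 — so a witness has range ≥ 1, and by the route's
  r3 conjecturally ≥ 2).

`DualCurrentTemplateR_of` (sorry-free) assembles: exact CR from `stub_localToGlobal`;
non-degeneracy by rewriting both observables of the certificate through `stub_obsEqBlockAverage`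
(depth `r + 2 ⇒ r`, `IsDeepAt.mono`); then `exists_isExactCR_and_nondegenerate_iff.mp` yields the
crux BY NAME.  Sorries: exactly the three `stub_*`.

**Lead reshape v2 (2026-08-17, line lead):** `stub_localToGlobal` is now PROVED in the skeleton
(`isExactCR_of_isLocallyCR`) from two definition-free stubs `stub_blockResummation` (a block
resummation vanishing for every exterior integrates to `0` under `P_{1/2}`) and
`stub_integrandIntegrable` (the template integrand of an admissible domain is integrable), and
`stub_obsEqBlockAverage` is stated with `blockAverage`/`integrand` unfolded; the heart
`stub_localSolution` is unchanged.  Sorries: exactly the four `stub_*`; `DualCurrentTemplateR_of :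
Sig.stub_blockResummation → Sig.stub_integrandIntegrable → Sig.stub_obsEqBlockAverage →
Sig.stub_localSolution → DualCurrentTemplateR` (rc 0, axioms propext / Classical.choice /
Quot.sound).  **Wave 1 landed (2026-08-17):** `stub_blockResummation` (p148916),
`stub_integrandIntegrable` (p148626), `stub_obsEqBlockAverage` (p148955) are closed by the Theorems
files `CardyDualCurrentDualCurrentTemplateRStub{BlockResummation,IntegrandIntegrable,ObsEqBlockAverage}`;
the only remaining `sorry` is the heart `stub_localSolution`.

Transfer (why the stronger local form is EASIER, not a costume): (i) it is the only mechanism by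
which an identity can hold in ALL admissible domains at once (the domain enters a deep stencil
only through the exterior interface datum, over which the local form quantifies); (ii) for fixed
`(T, ρ)` it is decidable instance by instance and its failure over a whole range class is a finite
linear-algebra certificate over `ℚ(ζ₂₄)` (the census method of r3 / `NoDualCurrentRangeZero`);
(iii) it is the native language of the Bernard–Felder lattice currents (IkhlefWestonWheelerZinnJustin2013
§4: a conserved current IS a pointwise block identity), where the route's "dual current" is to be
found or excluded.

Disproof used: none on file for this crux (`ledger crux ls stmt-CriticalPhenomena-11201`: no
workfiles, no `Disproof.lean`, no `Negative/` lemmas, 2026-08-17).  Negatives index: the only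
related entry is the refuted-misstated first typing `stmt-CriticalPhenomena-6949` (junk
`SimpleGraph.dist` windows); every notion here goes through the `edist`-based structure API of
`LocalParafermionicTemplate`, i.e. the repaired typing, and no stub is an instance of it.

Checks (2026-08-17, `lean check --json`): rc 0, errors `[]`, sorries 3 = the three `stub_*`
declarations (the only `declaration uses sorry` warnings), none elsewhere; `DualCurrentTemplateR_of`
has axioms `{propext, Classical.choice, Quot.sound}` (no `sorryAx`) and the audit block records it
as proving `…Theses.CardyDualCurrent.DualCurrentTemplateR` under exactly the hypotheses
`Sig.stub_localToGlobal`, `Sig.stub_obsEqBlockAverage`, `Sig.stub_localSolution`.  BC3 probes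
(registrar folder `bc/stub_*_probe.lean`: these defs verbatim, no stubs, no composition;
`maxHeartbeats 400000`): for each of the three stubs, `stub → DualCurrentTemplateR` and
`stub → CardyFormulaZ2` by `first | exact? | simpa | aesop` and by the BC2 form
`first | exact? | simpa [S] | (unfold S; simpa) | aesop` all FAIL with unsolved goals after
aesop's exhaustive search — 12/12 failed: no stub is cheaply the crux or the summit.
-/

noncomputable section

namespace Summit.CriticalPhenomena.CardyFormulaZ2.Cruxes.DualCurrentTemplateR.Birth

open scoped Classical
open MeasureTheory
open Literature.Probability.LatticeModels Literature.Probability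
open Summit.CriticalPhenomena.CardyFormulaZ2.Theses.CardyDualCurrent (DualCurrentTemplateR)

/-! ### The integrand of the template observable and its Cauchy–Riemann defects -/

/-- The integrand of the template observable at the base point `x` of type `i` in the domain
`D`, as a function of the configuration `ω`:
`Σ_k g i k (ω ∩ translated window, relative coordinates) · passageSum γ(ω) (s i k) (x + z i k)`. -/
def integrand (T : LocalParafermionicTemplate) (D : DiscreteDobrushin)
    (ω : Percolation.BondConfig (Site 2)) (x : Site 2) (i : Fin 2) : ℂ :=
  ∑ k, T.g i k {e | medialGraph.edist s((0 : Site 2), Pi.single i 1) e ≤ (T.r : ℕ∞) ∧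
      Sym2.map (· + x) e ∈ ω} *
    passageSum (fkInterface D ω) D.δ (T.s i k) (Sym2.map (· + x) (T.z i k))

/-- `T.obs` is the `P_{1/2}`-expectation of `integrand` (definitional). -/
theorem obs_eq_integral_integrand (T : LocalParafermionicTemplate) (D : DiscreteDobrushin)
    (x : Site 2) (i : Fin 2) :
    T.obs D x i =
      ∫ ω, integrand T D ω x i ∂(Percolation.bondPercolation (zdGraph 2) Percolation.half) :=
  rfl

/-- The Duffin CR defect of the integrand around the primal VERTEX `x`, configuration-wise:
`I(x,1) - I(x-e₁,1) - i (I(x,0) - I(x-e₀,0))` (`N - S - i (E - W)`). -/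
def vertexDefect (T : LocalParafermionicTemplate) (D : DiscreteDobrushin)
    (ω : Percolation.BondConfig (Site 2)) (x : Site 2) : ℂ :=
  integrand T D ω x 1 - integrand T D ω (x - Pi.single 1 1) 1 -
    Complex.I * (integrand T D ω x 0 - integrand T D ω (x - Pi.single 0 1) 0)

/-- The Duffin CR defect of the integrand around the primal FACE with lower-left corner `f`,
configuration-wise: `I(f+e₁,0) - I(f,0) - i (I(f+e₀,1) - I(f,1))`. -/
def faceDefect (T : LocalParafermionicTemplate) (D : DiscreteDobrushin)
    (ω : Percolation.BondConfig (Site 2)) (f : Site 2) : ℂ :=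
  integrand T D ω (f + Pi.single 1 1) 0 - integrand T D ω f 0 -
    Complex.I * (integrand T D ω (f + Pi.single 0 1) 1 - integrand T D ω f 1)

/-! ### Resummation blocks and block sums -/

/-- The sites within sup-distance `ρ` of `x`. -/
def siteBox (x : Site 2) (ρ : ℕ) : Finset (Site 2) :=
  Fintype.piFinset fun j => Finset.Icc (x j - ρ) (x j + ρ)

/-- The resummation block: the lattice edges of `ℤ²` with both endpoints within sup-distance `ρ`
of `x` (a finite set of genuine edges, `coe_edgeBox_subset_edgeSet`). -/
def edgeBox (x : Site 2) (ρ : ℕ) : Finset MedialVertex :=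
  ((siteBox x ρ ×ˢ siteBox x ρ).filter fun p => (zdGraph 2).Adj p.1 p.2).image fun p => s(p.1, p.2)

/-- The block consists of edges of `ℤ²`. -/
theorem coe_edgeBox_subset_edgeSet (x : Site 2) (ρ : ℕ) :
    (↑(edgeBox x ρ) : Set MedialVertex) ⊆ (zdGraph 2).edgeSet := by
  intro e he
  rw [Finset.mem_coe, edgeBox, Finset.mem_image] at he
  obtain ⟨p, hp, rfl⟩ := he
  rw [Finset.mem_filter] at hp
  exact (SimpleGraph.mem_edgeSet _).2 hp.2

/-- **Block sum with frozen exterior**: the sum of `Φ` over the `2^|B|` configurations that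
agree with `ω` off the block `B`. -/
def blockSum (B : Finset MedialVertex) (Φ : Percolation.BondConfig (Site 2) → ℂ)
    (ω : Percolation.BondConfig (Site 2)) : ℂ :=
  ∑ η ∈ B.powerset, Φ ((ω \ (↑B : Set MedialVertex)) ∪ (↑η : Set MedialVertex))

/-- **Block average**: the uniform average of `Φ` over the configurations supported in `E`. -/
def blockAverage (E : Finset MedialVertex) (Φ : Percolation.BondConfig (Site 2) → ℂ) : ℂ :=
  ((2 : ℂ) ^ E.card)⁻¹ * ∑ η ∈ E.powerset, Φ (↑η : Set MedialVertex)

/-! ### Local Cauchy–Riemann -/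

/-- **`T` is locally Cauchy–Riemann**: for some block radius `ρ`, in every admissible discrete
Dobrushin domain with preconnected wired arc, at every primal vertex `x` and every primal face
`f` whose four stencil windows are `T.r`-deep (exactly the stencils of `T.IsExactCRIn`), the
block resummation over `edgeBox · ρ` of the corresponding CR defect of the integrand vanishes
for EVERY configuration (i.e. for every frozen exterior). -/
def IsLocallyCR (T : LocalParafermionicTemplate) : Prop :=
  ∃ ρ : ℕ, ∀ D : DiscreteDobrushin, D.IsZdAdmissible →
    ((discreteDomainGraph D.Ω D.δ).induce D.zdArcA).Preconnected →
    (∀ x, T.IsDeep D x 0 → T.IsDeep D x 1 → T.IsDeep D (x - Pi.single 0 1) 0 →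
        T.IsDeep D (x - Pi.single 1 1) 1 →
      ∀ ω, blockSum (edgeBox x ρ) (fun ω' => vertexDefect T D ω' x) ω = 0) ∧
    (∀ f, T.IsDeep D f 0 → T.IsDeep D (f + Pi.single 1 1) 0 → T.IsDeep D f 1 →
        T.IsDeep D (f + Pi.single 0 1) 1 →
      ∀ ω, blockSum (edgeBox f ρ) (fun ω' => faceDefect T D ω' f) ω = 0)

/-! ### Sanity: the definitions compute on the empty template

The empty template (`m = 0`, observable `0`) is locally CR — `IsLocallyCR` is inhabited in kind,
exactly as `IsExactCR` is (`isExactCR_empty`) — and all its block averages vanish, so it carries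
no non-constancy certificate: as in the route, non-degeneracy is what the heart must earn. -/

/-- The empty template has integrand `0`. -/
@[simp] theorem integrand_empty (r : ℕ) (D : DiscreteDobrushin)
    (ω : Percolation.BondConfig (Site 2)) (x : Site 2) (i : Fin 2) :
    integrand (LocalParafermionicTemplate.empty r) D ω x i = 0 := by
  simp [integrand, LocalParafermionicTemplate.empty]

/-- The empty template is locally CR (block radius `0`). -/
theorem isLocallyCR_empty (r : ℕ) : IsLocallyCR (LocalParafermionicTemplate.empty r) :=
  ⟨0, fun _ _ _ =>
    ⟨fun x _ _ _ _ ω => by simp [blockSum, vertexDefect],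
     fun f _ _ _ _ ω => by simp [blockSum, faceDefect]⟩⟩

/-- The empty template has vanishing block averages (no certificate). -/
theorem blockAverage_integrand_empty (r : ℕ) (E : Finset MedialVertex) (D : DiscreteDobrushin)
    (x : Site 2) (i : Fin 2) :
    blockAverage E (fun ω => integrand (LocalParafermionicTemplate.empty r) D ω x i) = 0 := by
  simp [blockAverage]

/-! ### Stub signatures

Lead reshape (2026-08-17, line lead `prover-line-stmt-CriticalPhenomena-11201-0`): the birth stub
`stub_localToGlobal : ∀ T, IsLocallyCR T → T.IsExactCR` is now a THEOREM of the skeleton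
(`isExactCR_of_isLocallyCR`, linearity of the Bochner integral), resting on two definition-free
stubs — `stub_blockResummation` (a pointwise-vanishing block resummation integrates to `0` under
`P_{1/2}`: toggle invariance of `setBer(E(ℤ²), 1/2)`) and `stub_integrandIntegrable` (the template
integrand of an admissible domain is integrable) — and `stub_obsEqBlockAverage` is stated with
`blockAverage` / `integrand` unfolded, so that every delegated stub is a statement over
Literature/Mathlib vocabulary only and lands as a plain Theorems file (no Defs file needed).
The composition idea is unchanged. -/

/-- Signature of `stub_blockResummation`: for a finite block `B` of lattice edges and an integrable
`F`, if the block resummation `∑_{η ⊆ B} F ((ω ∖ B) ∪ η)` vanishes for every configuration `ω`, then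
`∫ F dP_{1/2} = 0` (each toggle `ω ↦ ω ∆ {e}`, `e ∈ E(ℤ²)`, preserves `setBer(E(ℤ²), 1/2)`, so
`∫ F = 2^{-|B|} ∑_{S ⊆ B} ∫ F (ω ∆ S) = 2^{-|B|} ∫ ∑_{η ⊆ B} F ((ω ∖ B) ∪ η)`). -/
def Sig.stub_blockResummation : Prop :=
  ∀ (B : Finset MedialVertex), (↑B : Set MedialVertex) ⊆ (zdGraph 2).edgeSet →
    ∀ (F : Percolation.BondConfig (Site 2) → ℂ),
      Integrable F (Percolation.bondPercolation (zdGraph 2) Percolation.half) →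
      (∀ ω : Percolation.BondConfig (Site 2),
        ∑ η ∈ B.powerset, F ((ω \ (↑B : Set MedialVertex)) ∪ (↑η : Set MedialVertex)) = 0) →
      ∫ ω, F ω ∂(Percolation.bondPercolation (zdGraph 2) Percolation.half) = 0

/-- Signature of `stub_integrandIntegrable`: in an admissible domain the template integrand
`ω ↦ ∑_k g i k (pattern of ω in the translated window) · passageSum (γ(ω)) (s i k) (x + z i k)` is
`P_{1/2}`-integrable (it is measurable — the pattern factor has finite range with cylinder fibres,
the passage factor factors through `medialExploration`, `measurable_of_medialExploration` — and
bounded, `norm_passageSum_fkInterface_le_two`). This is `Integrable (integrand T D · x i)`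
definitionally. -/
def Sig.stub_integrandIntegrable : Prop :=
  ∀ (T : LocalParafermionicTemplate) (D : DiscreteDobrushin), D.IsZdAdmissible →
    ∀ (x : Site 2) (i : Fin 2),
      Integrable (fun ω : Percolation.BondConfig (Site 2) =>
          ∑ k, T.g i k {e | medialGraph.edist s((0 : Site 2), Pi.single i 1) e ≤ (T.r : ℕ∞) ∧
              Sym2.map (· + x) e ∈ ω} *
            passageSum (fkInterface D ω) D.δ (T.s i k) (Sym2.map (· + x) (T.z i k)))
        (Percolation.bondPercolation (zdGraph 2) Percolation.half)

/-- Signature of `stub_obsEqBlockAverage`: in an admissible domain, at a deep base point, the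
template observable is the uniform average of the integrand over the configurations of any finite
set of lattice edges containing `E(Ω_δ)` — stated with `blockAverage` and `integrand` unfolded
(definitionally `T.obs D x i = blockAverage E (fun ω => integrand T D ω x i)`). -/
def Sig.stub_obsEqBlockAverage : Prop :=
  ∀ (T : LocalParafermionicTemplate) (D : DiscreteDobrushin) (E : Finset MedialVertex),
    D.IsZdAdmissible → (discreteDomainGraph D.Ω D.δ).edgeSet ⊆ (↑E : Set MedialVertex) →
    (↑E : Set MedialVertex) ⊆ (zdGraph 2).edgeSet →
    ∀ (x : Site 2) (i : Fin 2), T.IsDeep D x i →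
      T.obs D x i = ((2 : ℂ) ^ E.card)⁻¹ * ∑ η ∈ E.powerset,
        ∑ k, T.g i k {e | medialGraph.edist s((0 : Site 2), Pi.single i 1) e ≤ (T.r : ℕ∞) ∧
            Sym2.map (· + x) e ∈ (↑η : Set MedialVertex)} *
          passageSum (fkInterface D (↑η : Set MedialVertex)) D.δ (T.s i k)
            (Sym2.map (· + x) (T.z i k))

/-- Signature of `stub_localSolution` (the heart): a locally-CR template with a finite
non-constancy certificate between two `(T.r + 2)`-deep base points of an admissible domain. -/
def Sig.stub_localSolution : Prop :=
  ∃ T : LocalParafermionicTemplate, IsLocallyCR T ∧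
    ∃ (D : DiscreteDobrushin) (E : Finset MedialVertex) (x x' : Site 2) (i : Fin 2),
      D.IsZdAdmissible ∧ ((discreteDomainGraph D.Ω D.δ).induce D.zdArcA).Preconnected ∧
      (discreteDomainGraph D.Ω D.δ).edgeSet ⊆ (↑E : Set MedialVertex) ∧
      (↑E : Set MedialVertex) ⊆ (zdGraph 2).edgeSet ∧
      D.IsDeepAt x i (T.r + 2) ∧ D.IsDeepAt x' i (T.r + 2) ∧
      blockAverage E (fun ω => integrand T D ω x i) ≠
        blockAverage E (fun ω => integrand T D ω x' i)

/-! ### The stubs -/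

/-- stub 1a — BLOCK RESUMMATION INTEGRATES TO ZERO (measure theory at `p = 1/2`: toggle
invariance of `setBer(E(ℤ²), 1/2)`). LANDED: `Theorems.stub_blockResummation`
(`Theorems/CardyDualCurrentDualCurrentTemplateRStubBlockResummation.lean`, wave 1 of the line lead;
its `Theorems.Sig.stub_blockResummation` is this signature verbatim, so the terms agree definitionally). -/
theorem stub_blockResummation : Sig.stub_blockResummation :=
  Summit.CriticalPhenomena.CardyFormulaZ2.Theorems.stub_blockResummation

/-- stub 1b — the template integrand of an admissible domain is `P_{1/2}`-integrable (measurable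
cylinder-type function, bounded). LANDED: `Theorems.stub_integrandIntegrable`
(`Theorems/CardyDualCurrentDualCurrentTemplateRStubIntegrandIntegrable.lean`, p148626). -/
theorem stub_integrandIntegrable : Sig.stub_integrandIntegrable :=
  Summit.CriticalPhenomena.CardyFormulaZ2.Theorems.stub_integrandIntegrable

/-- stub 2 — the observable of an admissible domain at a deep point is a finite uniform average
(cylinder functional; uniform `E`-marginal of `setBer(E(ℤ²), 1/2)`). LANDED:
`Theorems.stub_obsEqBlockAverage`
(`Theorems/CardyDualCurrentDualCurrentTemplateRStubObsEqBlockAverage.lean`). -/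
theorem stub_obsEqBlockAverage : Sig.stub_obsEqBlockAverage :=
  Summit.CriticalPhenomena.CardyFormulaZ2.Theorems.stub_obsEqBlockAverage

/-- stub 3 — THE HEART (open): a locally-CR template with a finite non-constancy certificate. -/
theorem stub_localSolution : Sig.stub_localSolution := by
  sorry

/-! ### Local CR integrates to exact CR (proved from stubs 1a, 1b) -/

/-- The integrand is integrable (stub 1b, restated through `integrand`). -/
theorem integrable_integrand (hI : Sig.stub_integrandIntegrable) (T : LocalParafermionicTemplate)
    {D : DiscreteDobrushin} (hD : D.IsZdAdmissible) (x : Site 2) (i : Fin 2) :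
    Integrable (fun ω => integrand T D ω x i)
      (Percolation.bondPercolation (zdGraph 2) Percolation.half) :=
  hI T D hD x i

/-- The integral of the vertex defect is the vertex CR defect of the observable (linearity). -/
theorem integral_vertexDefect (hI : Sig.stub_integrandIntegrable) (T : LocalParafermionicTemplate)
    {D : DiscreteDobrushin} (hD : D.IsZdAdmissible) (x : Site 2) :
    ∫ ω, vertexDefect T D ω x ∂(Percolation.bondPercolation (zdGraph 2) Percolation.half) =
      T.obs D x 1 - T.obs D (x - Pi.single 1 1) 1 -
        Complex.I * (T.obs D x 0 - T.obs D (x - Pi.single 0 1) 0) := by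
  have h := fun y j => integrable_integrand hI T hD y j
  have h1 : Integrable (fun ω => integrand T D ω x 1 - integrand T D ω (x - Pi.single 1 1) 1)
      (Percolation.bondPercolation (zdGraph 2) Percolation.half) := (h _ _).sub (h _ _)
  have h2 : Integrable (fun ω => Complex.I *
      (integrand T D ω x 0 - integrand T D ω (x - Pi.single 0 1) 0))
      (Percolation.bondPercolation (zdGraph 2) Percolation.half) := ((h _ _).sub (h _ _)).const_mul _
  simp only [vertexDefect, obs_eq_integral_integrand]
  rw [integral_sub h1 h2, integral_sub (h _ _) (h _ _), integral_const_mul,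
    integral_sub (h _ _) (h _ _)]

/-- The integral of the face defect is the face CR defect of the observable (linearity). -/
theorem integral_faceDefect (hI : Sig.stub_integrandIntegrable) (T : LocalParafermionicTemplate)
    {D : DiscreteDobrushin} (hD : D.IsZdAdmissible) (f : Site 2) :
    ∫ ω, faceDefect T D ω f ∂(Percolation.bondPercolation (zdGraph 2) Percolation.half) =
      T.obs D (f + Pi.single 1 1) 0 - T.obs D f 0 -
        Complex.I * (T.obs D (f + Pi.single 0 1) 1 - T.obs D f 1) := by
  have h := fun y j => integrable_integrand hI T hD y j
  have h1 : Integrable (fun ω => integrand T D ω (f + Pi.single 1 1) 0 - integrand T D ω f 0)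
      (Percolation.bondPercolation (zdGraph 2) Percolation.half) := (h _ _).sub (h _ _)
  have h2 : Integrable (fun ω => Complex.I *
      (integrand T D ω (f + Pi.single 0 1) 1 - integrand T D ω f 1))
      (Percolation.bondPercolation (zdGraph 2) Percolation.half) := ((h _ _).sub (h _ _)).const_mul _
  simp only [faceDefect, obs_eq_integral_integrand]
  rw [integral_sub h1 h2, integral_sub (h _ _) (h _ _), integral_const_mul,
    integral_sub (h _ _) (h _ _)]

/-- **Local CR integrates to exact CR** (the birth stub `stub_localToGlobal`, now proved from
stubs 1a and 1b): at a deep stencil of an admissible domain the block resummation of the defect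
vanishes for every exterior (`IsLocallyCR`), hence the defect integrates to `0`
(`stub_blockResummation`, the defect being integrable by `stub_integrandIntegrable`), and by
linearity this is the Cauchy–Riemann clause of `IsExactCRIn`. -/
theorem isExactCR_of_isLocallyCR (hR : Sig.stub_blockResummation)
    (hI : Sig.stub_integrandIntegrable) (T : LocalParafermionicTemplate) (hloc : IsLocallyCR T) :
    T.IsExactCR := by
  obtain ⟨ρ, hρ⟩ := hloc
  intro D hD hA
  obtain ⟨hV, hF⟩ := hρ D hD hA
  have h := fun y j => integrable_integrand hI T hD y j
  constructor
  · intro x h0 h1 h0' h1'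
    have hint : Integrable (fun ω => vertexDefect T D ω x)
        (Percolation.bondPercolation (zdGraph 2) Percolation.half) :=
      ((h _ _).sub (h _ _)).sub (((h _ _).sub (h _ _)).const_mul _)
    have hzero := hR (edgeBox x ρ) (coe_edgeBox_subset_edgeSet x ρ) _ hint (hV x h0 h1 h0' h1')
    rw [integral_vertexDefect hI T hD x] at hzero
    exact sub_eq_zero.mp hzero
  · intro f h0 h0' h1 h1'
    have hint : Integrable (fun ω => faceDefect T D ω f)
        (Percolation.bondPercolation (zdGraph 2) Percolation.half) :=
      ((h _ _).sub (h _ _)).sub (((h _ _).sub (h _ _)).const_mul _)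
    have hzero := hR (edgeBox f ρ) (coe_edgeBox_subset_edgeSet f ρ) _ hint (hF f h0 h0' h1 h1')
    rw [integral_faceDefect hI T hD f] at hzero
    exact sub_eq_zero.mp hzero

/-- The observable at a deep point is the block average of the integrand (stub 2, restated through
`blockAverage` / `integrand`). -/
theorem obs_eq_blockAverage (hBA : Sig.stub_obsEqBlockAverage) (T : LocalParafermionicTemplate)
    {D : DiscreteDobrushin} {E : Finset MedialVertex} (hD : D.IsZdAdmissible)
    (hEΩ : (discreteDomainGraph D.Ω D.δ).edgeSet ⊆ (↑E : Set MedialVertex))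
    (hEzd : (↑E : Set MedialVertex) ⊆ (zdGraph 2).edgeSet) {x : Site 2} {i : Fin 2}
    (hx : T.IsDeep D x i) :
    T.obs D x i = blockAverage E (fun ω => integrand T D ω x i) :=
  hBA T D E hD hEΩ hEzd x i hx

/-! ### The composition (sorry-free): the one open stub gives the crux BY NAME -/

/-- **`DualCurrentTemplateR` from the heart `stub_localSolution`.** The three library stubs landed
in wave 1 (`stub_blockResummation`, `stub_integrandIntegrable`, `stub_obsEqBlockAverage`, closed
above by their Theorems files) are used directly, so the skeleton's only hypothesis is the
registered open stub. Exact CR of the witness template from `isExactCR_of_isLocallyCR` (stubs 1a,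
1b); non-degeneracy from the finite certificate, both observables being block averages by
`stub_obsEqBlockAverage` (depth `r + 2 ⇒ r`); finally the Literature re-bracketing
`exists_isExactCR_and_nondegenerate_iff` turns `∃ T, T.IsExactCR ∧ T.Nondegenerate` into the
route's binder-level text. -/
theorem DualCurrentTemplateR_of :
    Sig.stub_localSolution →
      Summit.CriticalPhenomena.CardyFormulaZ2.Theses.CardyDualCurrent.DualCurrentTemplateR := by
  intro hS
  obtain ⟨T, hloc, D, E, x, x', i, hD, hA, hEΩ, hEzd, hx, hx', hne⟩ := hS
  -- exact discrete holomorphicity of the witness: local CR integrates (stubs 1a, 1b, landed)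
  have hCR : T.IsExactCR :=
    isExactCR_of_isLocallyCR stub_blockResummation stub_integrandIntegrable T hloc
  -- non-degeneracy: the certificate contradicts constancy on the (r+2)-deep points of D
  have hND : T.Nondegenerate := by
    intro hconst
    apply hne
    have h : T.obs D x i = T.obs D x' i := hconst D hD hA x x' i hx hx'
    rwa [obs_eq_blockAverage stub_obsEqBlockAverage T hD hEΩ hEzd (hx.mono (Nat.le_add_right _ _)),
      obs_eq_blockAverage stub_obsEqBlockAverage T hD hEΩ hEzd
        (hx'.mono (Nat.le_add_right _ _))] at h
  -- the crux by name, via the Literature re-bracketing of the structure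
  exact LocalParafermionicTemplate.exists_isExactCR_and_nondegenerate_iff.mp ⟨T, hCR, hND⟩

end Summit.CriticalPhenomena.CardyFormulaZ2.Cruxes.DualCurrentTemplateR.Birth

end
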